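import Summits.HodgeConjecture.HodgeConjecture.Theorems.SixfoldTableXCoverK3PDegenerateCMCurves
import HarnessLib

/-!
# TABLE X (dimension 6) — the K3-partner cell's CM-curve members `Y × E′ × E″` CLOSED: the same-field dichotomy of R25-6 typed
# (cell `pub-hodgeav-hg6`, req-37 (A) Q2b; eng-4 g9, brick R25-7 (reassigned from eng-3 g4); lead g4 GO 2026-08-29T09:09:29Z)

HONEST FRAMING. HC, `HC_AV` (stmt-1333), `HC_CM` (stmt-3052) and H2 are NOT proved and do not occur. KERNEL ONLY: one `by_cases`
over existing declarations; no definition, no `sorry`, no named fact; restates nothing. RECORD HYGIENE, not a verdict move: the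
CM-curves sub-case of the K3P-degenerate cover (`SixfoldTableXCoverK3PDegenerateCMCurves`, eng-2 g7, R25-6 v1 + v2) was certified in
two branches — v1 under the no-embedding datum `hnoE′ : ∀ z ∈ Z(End⁰ E′), z·z ≠ −d″` («`E″`'s field does not sit in `End⁰(E′)`»)
and v2 under `hE : E″ ∼ E′` — with the dichotomy «`Hom(E″, E′) ≠ 0` iff same CM field» left as WORDS. The tree already holds that
dichotomy in contrapositive form: `forall_center_mul_self_ne_of_not_isIsogenous_cmCurves` (`HodgeTheory/CentreTimesCMCurveNoEmbedding`:
two NON-isogenous elliptic curves, the second of CM type ⟹ no central element of `End⁰` of the second squares to `−d₀`;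
Moonen–Zarhin 1999 Thm. 0.2 (2) case (f), Deligne–Milne). This file runs the `by_cases` and lands the three theorems of R25-6 with
the branch datum `hnoE′` ∕ `hE` STRUCK:
* `isStablyNondegenerate_row25_cmCurves`, **`hodgeConjectureFor_row25_cmCurves`**, `not_k3pDegenerate_of_quarticCentre_prod_cmCurves'`
  — every `A ∼ Y × (E′ × E″)` with `Y` in R10's class, `E′`, `E″` CM elliptic curves whose fields `ℚ(√−d′)`, `ℚ(√−d″)` do not embed
  into `Z(End⁰ Y)` (`hno′`, `hno″`): `B = D` on all powers, HC, and OUTSIDE the degenerate sub-cell — UNCONDITIONAL, no branch datum.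
All declarations in `TableX` (R25-6's namespace); typed ≠ proved.

## References
* [MoonenZarhin1999LowDim] B. Moonen, Yu. Zarhin, Math. Ann. 315 (1999), Thm. 0.2 (2) case (f), §3 Prop. (3.8), Thm. (3.2), §5 (5.11).
* [vanGeemen1994HodgeAV] B. van Geemen, LNM 1594 (1994), §2.4–2.5, §3.6–3.7.
* [DeligneMilne1982Tannakian] P. Deligne, J. S. Milne, LNM 900 (1982), §6 Thm. 6.20.
-/

set_option linter.dupNamespace false

noncomputable section

open CategoryTheory
open Literature.AlgebraicGeometry Literature.AlgebraicGeometry.Motives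
open Literature.AlgebraicGeometry.Motives.AbelianVariety (IsIsogenous IsSimple isSimple_of_dim_le_one)
open Literature.AlgebraicGeometry.HodgeTheory
open Literature.AlgebraicGeometry.ComplexMultiplication
open Literature.AlgebraicGeometry.Milne1999
open Literature.AlgebraicTopology.SingularHomology
open Literature.Barriers.HodgeConjecture
open Summit.HodgeConjecture.HodgeConjecture.Ring2.ClassTargets
open Summit.HodgeConjecture.HodgeConjecture.Ring2.Motiv (ProdCMCell)
open Summit.HodgeConjecture.HodgeConjecture.Ring2.Atlas (IsQuarticFieldTypeIVFourfold)

namespace Summit.HodgeConjecture.HodgeConjecture.TableX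

section CMCurvesClosed

variable {Y E' E'' : AbelianVariety ℂ} {φY : Y ⟶ Y} {μ₁ μ₂ : ℂ} {χ' : E' ⟶ E'} {χ'' : E'' ⟶ E''} {d' d'' : ℕ}

/-- **`A ∼ Y × (E′ × E″)` is stably nondegenerate with NO branch datum** (`Y` in R10's class; `E′`, `E″` elliptic curves with
`χ′² = −d′`, `χ″² = −d″`; `ℚ(√−d′)`, `ℚ(√−d″) ⊄ Z(End⁰ Y)`): if some central `z ∈ End⁰(E′)` has `z² = −d″` then `E″ ∼ E′` (else
`forall_center_mul_self_ne_of_not_isIsogenous_cmCurves` would forbid `z`) and R25-6 v2 applies; otherwise R25-6 v1 applies with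
`hnoE′` := the negation. [cite: MoonenZarhin1999LowDim, Thm. 0.2 (2) case (f), §3 Prop. (3.8) and Thm. (3.2)]
[cite: vanGeemen1994HodgeAV, §2.4–2.5 and §3.6–3.7] -/
theorem isStablyNondegenerate_row25_cmCurves {A : AbelianVariety ℂ} (hYs : Y.IsSimple)
    (hE4 : Module.finrank ℚ Y.endAlgebra = 4) (h11 : starRingEnd ℂ μ₁ ≠ μ₁) (h22 : starRingEnd ℂ μ₂ ≠ μ₂) (h12 : μ₂ ≠ μ₁)
    (h12' : μ₂ ≠ starRingEnd ℂ μ₁) (h1 : eigenMultiplicity Y φY μ₁ = 1)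
    (h1' : eigenMultiplicity Y φY (starRingEnd ℂ μ₁) = 1) (h2 : eigenMultiplicity Y φY μ₂ = 2) (hY4 : Y.dim = 4)
    (hE'1 : E'.dim = 1) (hd' : 0 < d') (hχ' : χ' ≫ χ' = -(d' • 𝟙 E')) (hE''1 : E''.dim = 1) (hd'' : 0 < d'')
    (hχ'' : χ'' ≫ χ'' = -(d'' • 𝟙 E''))
    (hno' : ∀ z ∈ Subalgebra.center ℚ Y.endAlgebra, z * z ≠ -((d' : ℚ) • 1))
    (hno'' : ∀ z ∈ Subalgebra.center ℚ Y.endAlgebra, z * z ≠ -((d'' : ℚ) • 1))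
    (hA : IsIsogenous A (Y.prod (E'.prod E''))) : IsStablyNondegenerate A := by
  by_cases hex : ∃ z ∈ Subalgebra.center ℚ E'.endAlgebra, z * z = -((d'' : ℚ) • 1)
  · -- the same CM field twice: `E″ ∼ E′`
    obtain ⟨z, hz, hzz⟩ := hex
    have hE : IsIsogenous E'' E' := by
      by_contra hni
      exact forall_center_mul_self_ne_of_not_isIsogenous_cmCurves hE''1 hE'1 (isOfCMType_of_hom_comp_self_eq_neg hE'1 hd' hχ')
        hni hd'' hχ'' z hz hzz
    exact isStablyNondegenerate_row25_cmCurves_of_isIsogenous hYs hE4 h11 h22 h12 h12' h1 h1' h2 hY4 hE'1 hd' hχ' hno' hE hA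
  · -- two different CM fields: the no-embedding datum `hnoE′` holds
    exact isStablyNondegenerate_row25_cmCurves_of_noEmbedding hYs hE4 h11 h22 h12 h12' h1 h1' h2 hY4 hE'1 hd' hχ' hE''1 hd'' hχ''
      hno' hno'' (fun z hz hzz => hex ⟨z, hz, hzz⟩) hA

/-- **The Hodge conjecture at every `A ∼ Y × (E′ × E″)` — UNCONDITIONAL, no branch datum** (`B = D` + Lefschetz `(1,1)`).
[cite: MoonenZarhin1999LowDim, Thm. 0.2 (2) case (f), §3 Prop. (3.8) and Thm. (3.2)] [cite: vanGeemen1994HodgeAV, §2.4 and Lemma 3.7] -/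
theorem hodgeConjectureFor_row25_cmCurves {A : AbelianVariety ℂ} (hYs : Y.IsSimple)
    (hE4 : Module.finrank ℚ Y.endAlgebra = 4) (h11 : starRingEnd ℂ μ₁ ≠ μ₁) (h22 : starRingEnd ℂ μ₂ ≠ μ₂) (h12 : μ₂ ≠ μ₁)
    (h12' : μ₂ ≠ starRingEnd ℂ μ₁) (h1 : eigenMultiplicity Y φY μ₁ = 1)
    (h1' : eigenMultiplicity Y φY (starRingEnd ℂ μ₁) = 1) (h2 : eigenMultiplicity Y φY μ₂ = 2) (hY4 : Y.dim = 4)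
    (hE'1 : E'.dim = 1) (hd' : 0 < d') (hχ' : χ' ≫ χ' = -(d' • 𝟙 E')) (hE''1 : E''.dim = 1) (hd'' : 0 < d'')
    (hχ'' : χ'' ≫ χ'' = -(d'' • 𝟙 E''))
    (hno' : ∀ z ∈ Subalgebra.center ℚ Y.endAlgebra, z * z ≠ -((d' : ℚ) • 1))
    (hno'' : ∀ z ∈ Subalgebra.center ℚ Y.endAlgebra, z * z ≠ -((d'' : ℚ) • 1))
    (hA : IsIsogenous A (Y.prod (E'.prod E''))) : HodgeConjectureFor A.dim A.X :=
  (isStablyNondegenerate_row25_cmCurves hYs hE4 h11 h22 h12 h12' h1 h1' h2 hY4 hE'1 hd' hχ' hE''1 hd'' hχ'' hno' hno''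
    hA).hodgeConjectureFor

/-- **Kernel certificate, no branch datum**: every `A ∼ Y × (E′ × E″)` as above lies OUTSIDE the narrowed K3P binder class of
`SixfoldTableXCoverK3PDegenerate`. [cite: MoonenZarhin1999LowDim, Thm. 0.2 (2) case (f), §3 Prop. (3.8) and Thm. (3.2)]
[cite: vanGeemen1994HodgeAV, §2.4 and §3.6] -/
theorem not_k3pDegenerate_of_quarticCentre_prod_cmCurves' {A : AbelianVariety ℂ} (hYs : Y.IsSimple)
    (hE4 : Module.finrank ℚ Y.endAlgebra = 4) (h11 : starRingEnd ℂ μ₁ ≠ μ₁) (h22 : starRingEnd ℂ μ₂ ≠ μ₂) (h12 : μ₂ ≠ μ₁)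
    (h12' : μ₂ ≠ starRingEnd ℂ μ₁) (h1 : eigenMultiplicity Y φY μ₁ = 1)
    (h1' : eigenMultiplicity Y φY (starRingEnd ℂ μ₁) = 1) (h2 : eigenMultiplicity Y φY μ₂ = 2) (hY4 : Y.dim = 4)
    (hE'1 : E'.dim = 1) (hd' : 0 < d') (hχ' : χ' ≫ χ' = -(d' • 𝟙 E')) (hE''1 : E''.dim = 1) (hd'' : 0 < d'')
    (hχ'' : χ'' ≫ χ'' = -(d'' • 𝟙 E''))
    (hno' : ∀ z ∈ Subalgebra.center ℚ Y.endAlgebra, z * z ≠ -((d' : ℚ) • 1))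
    (hno'' : ∀ z ∈ Subalgebra.center ℚ Y.endAlgebra, z * z ≠ -((d'' : ℚ) • 1))
    (hA : IsIsogenous A (Y.prod (E'.prod E''))) :
    ¬ (ProdCMCell IsQuarticFieldTypeIVFourfold (fun Z ↦ Z.dim = 2) A ∧ ¬ IsStablyNondegenerate A) := fun h ↦
  h.2 (isStablyNondegenerate_row25_cmCurves hYs hE4 h11 h22 h12 h12' h1 h1' h2 hY4 hE'1 hd' hχ' hE''1 hd'' hχ'' hno' hno'' hA)

end CMCurvesClosed

end Summit.HodgeConjecture.HodgeConjecture.TableX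

end
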